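import Mathlib
import Literature.AlgebraicGeometry.Resolution.CobordantGame
import Literature.AlgebraicGeometry.Resolution.FormalCoordinateChange
import Summits.ResolutionOfSingularities.ResolutionOfSingularities.Theorems.WeightedInvariantLocalWeightedDropPlaneWon
import Summits.ResolutionOfSingularities.ResolutionOfSingularities.Theorems.WeightedInvariantLocalWeightedDropTerminalDoublePointsAux
import Summits.ResolutionOfSingularities.ResolutionOfSingularities.Theorems.WeightedInvariantLocalWeightedDropTerminalDoublePoints
import Summits.ResolutionOfSingularities.ResolutionOfSingularities.Theorems.WeightedInvariantLocalWeightedDropInsepPointStep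
import Summits.ResolutionOfSingularities.ResolutionOfSingularities.Theorems.WeightedInvariantLocalWeightedDropSeparablePointStep
import Summits.ResolutionOfSingularities.ResolutionOfSingularities.Theorems.WeightedInvariantLocalWeightedDropKangarooWalkAux

/-!
# `WeightedInvariant.LocalWeightedDrop`, line `hasse-ridge-face-selection`: HAUSER'S KANGAROO GERM `x² + y⁷ + yz⁴` IS WON

Crux item stmt-ResolutionOfSingularities-8899 `LocalWeightedDrop` (route `ResolutionOfSingularities/WeightedInvariant`),
serving the door `WeightedConstruction` stmt-ResolutionOfSingularities-0571.  [OURS · L1 W4.3, chain w43, stub worker 3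
(gen 2): calibration (c3) of CRUX-PLAN v2 IN KERNEL FORM — the specimen of the kill test K4.3 / of the barrier
`Literature.Barriers.ResolutionOfSingularities.KangarooShadeIncrease` is won in the local weighted resolution game by CLASSICAL
moves (point and curve blow-ups, weights in `{0,1}`) and char-`2` cleanings `y ↦ y + φ(x)`; NOT a statement of any manuscript
(Hauser's germ is the INPUT, the strategy is ours).]

THE WALK (`y = X (Fin.last 2)`, `A₀ = x₀⁷ + x₀x₁⁴`, i.e. Hauser's `x² + y⁷ + yz⁴` with `(x, y, z) = (y, x₀, x₁)`):
1. point blow-up (`won_insep_of_pointStep`): in the chart of `x₀` the successor is `x₀³(c₀⁷x₀² + c₀(c₁+x₁)⁴)` — terminal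
   `x₀³·unit` if `c₁ ≠ 0`, else the QUINTIC `c₀⁷x₀⁵ + c₀x₀³x₁⁴`; in the chart of `x₁` it is `x₀³(c₀+x₁)(c₁⁴ + x₀²(c₀+x₁)⁶)` —
   terminal `x₀³·unit` or `x₀³x₁·unit` (`hauserKangarooWon`);
2. the quintic `a x₀⁵ + b x₀³x₁⁴`: blow up the curve `V(x₀, y)` (`won_insep_of_curveStep`): successors `a c⁵ x₀³ + b c³ x₀x₁⁴`
   (`KangarooWalk.quintic_won`);
3. the cubic-quartic `a x₀³ + b x₀x₁⁴`: point blow-up; every successor has order `1` (no position) except, at the origin of the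
   chart of `x₁`, the THREE-LINES position `a x₀x₁³ + b c₁⁴ x₀³x₁` (`KangarooWalk.cubicQuartic_won`);
4. the three-lines position is won by one more point blow-up and cleanings (`threeLinesDoublePointWon`, file
   `…KangarooWalkAux`): this is where the characteristic-`2` CLEANING acts (`x₀²·((c₁+x₁)(γ² + a x₁²) + c₁γ²)`), i.e. the
   translational move of the kangaroo point; the cleaned successors are terminal (`binomialDoublePointWon`).
No wild point is visited; only the one-variable singular germs (`PlaneWon.lineWon`) enter.
-/

set_option linter.dupNamespace false -- mandated namespace of this single-conjunct summit

namespace Summit.ResolutionOfSingularities.ResolutionOfSingularities.Theorems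

open Literature.AlgebraicGeometry.Resolution
open Literature.AlgebraicGeometry.Resolution.CobordantGame

namespace KangarooWalk

open MvPowerSeries

variable {k : Type} [Field k]

/-- The curve chart `ρ_{0,c}`: `x₀ ↦ c x₀`. -/
theorem rho_zero_apply_zero (c : k) :
    (if (0 : Fin 2) = 0 then C c * X 0 else (X 1 : MvPowerSeries (Fin 2) k)) = C c * X 0 :=
  if_pos rfl

/-- The curve chart `ρ_{0,c}`: `x₁ ↦ x₁`. -/
theorem rho_zero_apply_one (c : k) :
    (if (1 : Fin 2) = 0 then C c * X 0 else (X 1 : MvPowerSeries (Fin 2) k)) = X 1 :=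
  if_neg one_ne_zero

/-- STEP 3 — THE CUBIC-QUARTIC `a x₀³ + b x₀x₁⁴` (`a, b ≠ 0`) IS WON (characteristic `2`, `k` algebraically closed): after the
point blow-up every successor has a linear term, except the three-lines position `a x₀x₁³ + b c₁⁴ x₀³x₁` at the origin of the
chart of `x₁`. -/
theorem cubicQuartic_won [CharP k 2] [IsAlgClosed k]
    (hlow : ∀ g : MvPowerSeries (Fin 1) k, CobordantGame.IsSingular k g → CobordantGame.Won k 1 g)
    {a b : k} (ha : a ≠ 0) (hb : b ≠ 0) :
    CobordantGame.Won k 3 (X (Fin.last 2) ^ 2 + rename (Fin.succAboveEmb (Fin.last 2))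
      (C a * X 0 ^ 3 * X 1 ^ 0 + C b * X 0 ^ 1 * X 1 ^ 4)) := by
  refine won_insep_of_pointStep k hlow _ ?_ fun c i₀ hc A' α β hfac hα hβ hord => ?_
  · have h3 : ((3 : ℕ) : ℕ∞) ≤ (C a * X 0 ^ 3 * X 1 ^ 0 + C b * X 0 ^ 1 * X 1 ^ 4 : MvPowerSeries (Fin 2) k).order :=
      le_order_add' (le_trans (by norm_num) (le_order_term a 3 0)) (le_trans (by norm_num) (le_order_term b 1 4))
    exact lt_of_lt_of_le (by norm_num) h3
  · have hs := InsepDoublePoint.hasSubst_pi i₀ c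
    rw [subst_add hs, subst_term hs, subst_term hs] at hfac
    rcases (by fin_cases i₀ <;> simp : i₀ = 0 ∨ i₀ = 1) with rfl | rfl
    · -- chart of `x₀`: the successor has the linear term `a c₀³ x₀`
      rw [pi_zero_apply_zero, pi_zero_apply_one] at hfac
      have hA' : A' = X 0 * (C a * C (c 0) ^ 3 + C b * C (c 0) * X 0 ^ 2 * (C (c 1) + X 1) ^ 4) :=
        eq_of_X_sq_mul_eq (by rw [← hfac]; ring)
      exfalso
      refine false_of_coeff_single_one_ne_zero hord 0 ?_
      rw [hA', SepTerminalDoublePoint.coeff_single_X_mul]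
      simp [constantCoeff_X, ha, hc]
    · -- chart of `x₁`
      rw [pi_one_apply_zero, pi_one_apply_one] at hfac
      by_cases hc0 : c 0 = 0
      · -- the origin of the chart: the three-lines position
        have hA' : A' = C a * X 0 * X 1 ^ 3 + C (b * c 1 ^ 4) * X 0 ^ 3 * X 1 :=
          eq_of_X_sq_mul_eq (by rw [← hfac, hc0, map_zero, zero_add, map_mul, map_pow]; ring)
        have h3 : ((3 : ℕ) : ℕ∞) ≤ A'.order := by
          have h : A' = C a * X 0 ^ 1 * X 1 ^ 3 + C (b * c 1 ^ 4) * X 0 ^ 3 * X 1 ^ 1 := by rw [hA', pow_one, pow_one]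
          rw [h]
          exact le_order_add' (le_trans (by norm_num) (le_order_term a 1 3)) (le_trans (by norm_num) (le_order_term _ 3 1))
        rw [add_sq_eq_self (eq_zero_of_sq_eq_coeff h3 0 hα) (eq_zero_of_sq_eq_coeff h3 1 hβ), hA']
        exact threeLinesDoublePointWon k ha (mul_ne_zero hb (pow_ne_zero 4 hc))
      · -- elsewhere: the linear term `a c₀³ x₀`
        have hA' : A' = X 0 * ((C (c 0) + X 1) * (C a * (C (c 0) + X 1) ^ 2 + C b * C (c 1) ^ 4 * X 0 ^ 2)) :=
          eq_of_X_sq_mul_eq (by rw [← hfac]; ring)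
        exfalso
        refine false_of_coeff_single_one_ne_zero hord 0 ?_
        rw [hA', SepTerminalDoublePoint.coeff_single_X_mul]
        simp [constantCoeff_X, ha, hc0]

/-- STEP 2 — THE QUINTIC `a x₀⁵ + b x₀³x₁⁴` (`a, b ≠ 0`) IS WON: blow up the curve `V(x₀, y)`; the successors are the
cubic-quartics `a c⁵ x₀³ + b c³ x₀x₁⁴`. -/
theorem quintic_won [CharP k 2] [IsAlgClosed k]
    (hlow : ∀ g : MvPowerSeries (Fin 1) k, CobordantGame.IsSingular k g → CobordantGame.Won k 1 g)
    {a b : k} (ha : a ≠ 0) (hb : b ≠ 0) :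
    CobordantGame.Won k 3 (X (Fin.last 2) ^ 2 + rename (Fin.succAboveEmb (Fin.last 2))
      (C a * X 0 ^ 5 * X 1 ^ 0 + C b * X 0 ^ 3 * X 1 ^ 4)) := by
  refine won_insep_of_curveStep k hlow 0 _ (C a * X 0 ^ 3 * X 1 ^ 0 + C b * X 0 ^ 1 * X 1 ^ 4) (by ring) ?_
    fun c hc A' α β hA' hα hβ _ => ?_
  · simp [constantCoeff_X]
  · have hs := TerminalDoublePoint.hasSubst_rho (k := k) 0 c
    rw [subst_add hs, subst_term hs, subst_term hs, rho_zero_apply_zero, rho_zero_apply_one] at hA'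
    have hA'' : A' = C (a * c ^ 5) * X 0 ^ 3 * X 1 ^ 0 + C (b * c ^ 3) * X 0 ^ 1 * X 1 ^ 4 := by
      rw [hA']; simp only [map_mul, map_pow]; ring
    have h3 : ((3 : ℕ) : ℕ∞) ≤ A'.order := by
      rw [hA'']
      exact le_order_add' (le_trans (by norm_num) (le_order_term _ 3 0)) (le_trans (by norm_num) (le_order_term _ 1 4))
    rw [add_sq_eq_self (eq_zero_of_sq_eq_coeff h3 0 hα) (eq_zero_of_sq_eq_coeff h3 1 hβ), hA'']
    exact cubicQuartic_won hlow (mul_ne_zero ha (pow_ne_zero 5 hc)) (mul_ne_zero hb (pow_ne_zero 3 hc))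

end KangarooWalk

open KangarooWalk InsepDoublePoint MvPowerSeries in
/-- HAUSER'S KANGAROO GERM IS WON (characteristic `2`, `k` algebraically closed): `y² + x₀⁷ + x₀x₁⁴` — Hauser's
`x² + y⁷ + yz⁴`, the specimen of `Literature.Barriers.ResolutionOfSingularities.KangarooShadeIncrease` and of the kill test
K4.3 — is in the winning region `CobordantGame.Won k 3` of the local weighted resolution game.  The winning strategy uses
only point blow-ups, blow-ups of curves `V(x_i, y)` and re-centrings `y ↦ y + φ(x)` (module docstring: the walk), and only
the one-variable singular germs as inputs (`PlaneWon.lineWon`).  [OURS · L1 W4.3, calibration (c3) of CRUX-PLAN v2 in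
kernel form: the barrier constrains usc invariants built from (order, shade, résumé), not the game.] -/
theorem hauserKangarooWon (k : Type) [Field k] [CharP k 2] [IsAlgClosed k] :
    CobordantGame.Won k 3 (MvPowerSeries.X (Fin.last 2) ^ 2 + MvPowerSeries.rename (Fin.succAboveEmb (Fin.last 2))
      (MvPowerSeries.X 0 ^ 7 + MvPowerSeries.X 0 * MvPowerSeries.X 1 ^ 4)) := by
  have hlow : ∀ g : MvPowerSeries (Fin 1) k, CobordantGame.IsSingular k g → CobordantGame.Won k 1 g :=
    fun g hg => PlaneWon.lineWon g hg
  have hA : (X 0 ^ 7 + X 0 * X 1 ^ 4 : MvPowerSeries (Fin 2) k) =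
      C 1 * X 0 ^ 7 * X 1 ^ 0 + C 1 * X 0 ^ 1 * X 1 ^ 4 := by rw [map_one]; ring
  rw [hA]
  refine won_insep_of_pointStep k hlow _ ?_ fun c i₀ hc A' α β hfac hα hβ _ => ?_
  · have h3 : ((3 : ℕ) : ℕ∞) ≤ (C 1 * X 0 ^ 7 * X 1 ^ 0 + C 1 * X 0 ^ 1 * X 1 ^ 4 : MvPowerSeries (Fin 2) k).order :=
      le_order_add' (le_trans (by norm_num) (le_order_term 1 7 0)) (le_trans (by norm_num) (le_order_term 1 1 4))
    exact lt_of_lt_of_le (by norm_num) h3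
  · have hs := hasSubst_pi i₀ c
    rw [subst_add hs, subst_term hs, subst_term hs, map_one, one_mul, one_mul] at hfac
    rcases (by fin_cases i₀ <;> simp : i₀ = 0 ∨ i₀ = 1) with rfl | rfl
    · -- chart of `x₀`
      rw [pi_zero_apply_zero, pi_zero_apply_one] at hfac
      have hA' : A' = X 0 ^ 3 * (C (c 0) ^ 7 * X 0 ^ 2 + C (c 0) * (C (c 1) + X 1) ^ 4) :=
        eq_of_X_sq_mul_eq (by rw [← hfac]; ring)
      have h3 : ((3 : ℕ) : ℕ∞) ≤ A'.order := by rw [hA']; exact le_order_X_pow_mul 0 3 _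
      rw [add_sq_eq_self (eq_zero_of_sq_eq_coeff h3 0 hα) (eq_zero_of_sq_eq_coeff h3 1 hβ)]
      by_cases hc1 : c 1 = 0
      · -- `c₁ = 0`: the quintic
        have hA'' : A' = C (c 0 ^ 7) * X 0 ^ 5 * X 1 ^ 0 + C (c 0) * X 0 ^ 3 * X 1 ^ 4 := by
          rw [hA', hc1, map_zero, zero_add, map_pow]; ring
        rw [hA'']
        exact quintic_won hlow (pow_ne_zero 7 hc) hc
      · -- `c₁ ≠ 0`: terminal `x₀³ · unit`
        have hA'' : A' = X 0 ^ 3 * X 1 ^ 0 * (C (c 0) ^ 7 * X 0 ^ 2 + C (c 0) * (C (c 1) + X 1) ^ 4) := by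
          rw [hA', pow_zero, mul_one]
        rw [hA'']
        exact TerminalDoublePoint.binomialDoublePointWon 2 Nat.prime_two k hlow 3 3 0 _ le_rfl
          (by simp [constantCoeff_X, hc, hc1]) (fun h => by have := h.1; omega)
    · -- chart of `x₁`
      rw [pi_one_apply_zero, pi_one_apply_one] at hfac
      have hA' : A' = X 0 ^ 3 * ((C (c 0) + X 1) * (X 0 ^ 2 * (C (c 0) + X 1) ^ 6 + C (c 1) ^ 4)) :=
        eq_of_X_sq_mul_eq (by rw [← hfac]; ring)
      have h3 : ((3 : ℕ) : ℕ∞) ≤ A'.order := by rw [hA']; exact le_order_X_pow_mul 0 3 _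
      rw [add_sq_eq_self (eq_zero_of_sq_eq_coeff h3 0 hα) (eq_zero_of_sq_eq_coeff h3 1 hβ)]
      by_cases hc0 : c 0 = 0
      · -- the origin of the chart: terminal `x₀³ x₁ · unit`
        have hA'' : A' = X 0 ^ 3 * X 1 ^ 1 * (X 0 ^ 2 * X 1 ^ 6 + C (c 1) ^ 4) := by
          rw [hA', hc0, map_zero, zero_add]; ring
        rw [hA'']
        exact TerminalDoublePoint.binomialDoublePointWon 2 Nat.prime_two k hlow 4 3 1 _ le_rfl
          (by simp [constantCoeff_X, hc]) (fun h => by have := h.1; omega)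
      · -- elsewhere: terminal `x₀³ · unit`
        have hA'' : A' = X 0 ^ 3 * X 1 ^ 0 * ((C (c 0) + X 1) * (X 0 ^ 2 * (C (c 0) + X 1) ^ 6 + C (c 1) ^ 4)) := by
          rw [hA', pow_zero, mul_one]
        rw [hA'']
        exact TerminalDoublePoint.binomialDoublePointWon 2 Nat.prime_two k hlow 3 3 0 _ le_rfl
          (by simp [constantCoeff_X, hc, hc0]) (fun h => by have := h.1; omega)

end Summit.ResolutionOfSingularities.ResolutionOfSingularities.Theorems
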